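import Summits.RiemannHypothesis.RiemannHypothesis.Theorems.Splittings.ScrewWindowRiseA
import HarnessLib

/-!
# Window-rise law for `Ψ = zetaScrew`, PART B: the rung `PowerSparseDetect`, RH ⟺ ½-Hölder, sparse node sets

CARVE NOTE (rh-split-typer-2 g5, lead RULING #102 (b′), 2026-08-27): PART B = lines 333–694 of the frozen object
`HOME/rh-split-screw-bridge/g10/ScrewWindowRise.lean` (sha16 233eb18714544943, 697 l; author rh-split-screw-bridge g10;
referee rh-split-ref-2 g2 REPLAY + NEGCTL + STUB-CHECK + LABELS PASS 12:28:52Z) reproduced BYTE-IDENTICALLY after this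
header; PART A (`Splittings/ScrewWindowRiseA.lean`, §§1–3; its module docstring is the source's full account) is imported
and the namespace `…Theorems.Splittings.ScrewWindowRise` re-opened, so all fully-qualified names are the refereed ones.
§4 `exists_supAbscissa`, `strip_of_abscissa_le`, `powerSparseDetect_of` (rung of line power-sparse-detect of crux
stmt-RiemannHypothesis-15757 from S1 + (W) + S3, S2 bypassed; S1/S3 UNFOLDED verbatim as hypotheses, no `Cruxes/…/Lines`
import); §5 `rh_of_sqrtHolder`, `rh_iff_sqrtHolder_of`; §6 `primes_dense` (Hoheisel), `powers_dense`,
`rh_iff_nonneg_at_primes_of`, `rh_iff_nonneg_at_powers_of`.  DECLARED (ref-2 g2): `exists_supAbscissa` is a byte-copy of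
`Cruxes.ScrewPolyFloor.Lines.PowerSparseDetect.exists_supAbscissa` (l.161 of the sorried, non-importable Lines module).
LABEL: RH-FREE (every declaration proved here; RH / quasi-RH only as hypotheses or inside equivalences); no statement,
proof or docstring byte changed by the carve.  HONEST LABEL: «SPLITTING SEARCH over kernel-typed RH-EQUIVALENCES; a
splitting A ∧ B ⟹ RH is CONDITIONAL bookkeeping unless A and B are both proved; nothing here bears on the truth of RH.»
-/

set_option linter.dupNamespace false

noncomputable section

open Complex Filter Set

namespace Summit.RiemannHypothesis.RiemannHypothesis.Theorems.Splittings.ScrewWindowRise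

open Literature.NumberTheory.LFunctions
open ZetaZeros.riemannZetaNontrivialZeros

/-! ## 4. The rung `PowerSparseDetect` from S1 + (W) + S3 (S2 bypassed) -/

/-- The sup-abscissa bookkeeping (as in the line file): under a zero in the open right half-strip
there is `Θ ∈ (1/2, 1]` bounding the real parts of the strip zeros and approximated from below by
real parts of zeros. -/
theorem exists_supAbscissa {s₀ : ℂ} (hs₀ : riemannZeta s₀ = 0) (h1 : 1 / 2 < s₀.re)
    (h2 : s₀.re < 1) :
    ∃ Θ : ℝ, 1 / 2 < Θ ∧ Θ ≤ 1 ∧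
      (∀ ρ : ℂ, riemannZeta ρ = 0 → 1 / 2 < ρ.re → ρ.re < 1 → ρ.re ≤ Θ) ∧
      (∀ y : ℝ, y < Θ → ∃ ρ : ℂ, riemannZeta ρ = 0 ∧ y < ρ.re ∧ 1 / 2 < ρ.re ∧ ρ.re < 1) := by
  set Z : Set ℝ := {x | ∃ s : ℂ, riemannZeta s = 0 ∧ 1 / 2 < s.re ∧ s.re < 1 ∧ s.re = x} with hZ
  have hs₀Z : s₀.re ∈ Z := ⟨s₀, hs₀, h1, h2, rfl⟩
  have hZne : Z.Nonempty := ⟨_, hs₀Z⟩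
  have hub : ∀ x ∈ Z, x ≤ 1 := by
    rintro x ⟨s, -, -, hs1, rfl⟩
    exact hs1.le
  have hZbdd : BddAbove Z := ⟨1, hub⟩
  refine ⟨sSup Z, h1.trans_le (le_csSup hZbdd hs₀Z), csSup_le hZne hub, ?_, ?_⟩
  · intro ρ h h' h''
    exact le_csSup hZbdd ⟨ρ, h, h', h'', rfl⟩
  · intro y hy
    obtain ⟨x, ⟨ρ, hρ, hρ1, hρ2, rfl⟩, hx⟩ := exists_lt_of_lt_csSup hZne hy
    exact ⟨ρ, hρ, hx, hρ1, hρ2⟩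

/-- A bound `Θ ≥ 1/2` on the real parts of the zeros in the right half-strip is STRIP(Θ − 1/2)
(reflection `ρ ↦ 1 − ρ`): no hypothesis on the zeros beyond the definition of `Θ`. -/
theorem strip_of_abscissa_le {Θ : ℝ} (hΘ : 1 / 2 ≤ Θ)
    (hzle : ∀ ρ : ℂ, riemannZeta ρ = 0 → 1 / 2 < ρ.re → ρ.re < 1 → ρ.re ≤ Θ) :
    ∀ ρ : ℂ, ρ ∈ ZetaZeros.riemannZetaNontrivialZeros → |ρ.re - 1 / 2| ≤ Θ - 1 / 2 := by
  intro ρ hρ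
  have hζ := zeta_eq_zero hρ
  have h0 := re_pos hρ
  have h1 := re_lt_one hρ
  rw [abs_le]
  constructor
  · by_cases h : ρ.re < 1 / 2
    · have h' := hzle (1 - ρ) (GeneralizedRH.riemannZeta_one_sub_eq_zero hζ h0 h1)
        (by simp only [sub_re, one_re]; linarith) (by simp only [sub_re, one_re]; linarith)
      simp only [sub_re, one_re] at h'
      linarith
    · have h' := not_lt.1 h
      linarith
  · by_cases h : 1 / 2 < ρ.re
    · have := hzle ρ hζ h h1
      linarith
    · have h' := not_lt.1 h
      linarith

/-- **THE RUNG `PowerSparseDetect` FROM S1 AND S3** (S2 replaced by the zero-side window-rise law,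
proved above). Hypotheses `h1`, `h3` are VERBATIM the line's `Sig.stub_omegaDepth`, `Sig.stub_denseHits`
(`Cruxes/ScrewPolyFloor/Lines/PowerSparseDetect.lean`); the conclusion is VERBATIM the unfolding of
`Theses.SparseScrew.PowerSparseDetect` (`∀ θ < 1, ∀ C, Rung C θ`). -/
theorem powerSparseDetect_of
    (h1 : ∀ η : ℝ, 0 ≤ η → (∃ ρ : ℂ, riemannZeta ρ = 0 ∧ 1 / 2 + η < ρ.re ∧ ρ.re < 1) →
      ∀ K T : ℝ, ∃ t : ℝ, T ≤ t ∧ 0 ≤ t ∧ zetaScrew t < -K * Real.exp (η * t))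
    (h3 : ∀ θ C : ℝ, θ < 1 → ∀ A : Set ℕ,
      (∀ m : ℕ, 1 ≤ m → ∃ a ∈ A, m ≤ a ∧ (a : ℝ) ≤ m + C * (m : ℝ) ^ θ) →
      ∃ δ : ℝ, 0 < δ ∧ δ ≤ 1 ∧ ∃ T : ℝ, 0 ≤ T ∧ ∀ t₀ L : ℝ, T ≤ t₀ → Real.exp (-(δ * t₀)) ≤ L →
        ∃ a ∈ A, 1 ≤ a ∧ t₀ ≤ Real.log a ∧ Real.log a ≤ t₀ + L) :
    ∀ θ : ℝ, θ < 1 → ∀ C : ℝ, ∀ A : Set ℕ,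
      (∀ m : ℕ, 1 ≤ m → ∃ a ∈ A, m ≤ a ∧ (a : ℝ) ≤ m + C * (m : ℝ) ^ θ) →
      (∀ m ∈ A, 0 ≤ zetaScrew (Real.log m)) → _root_.RiemannHypothesis := by
  intro θ hθ C A hA hpos
  refine quasiRiemannHypothesis_one_half_iff_holds.1 fun s₀ hs₀ h1₀ h2₀ ↦ ?_
  -- the sup abscissa Θ ∈ (1/2, 1] and the strip it defines
  obtain ⟨Θ, hΘhalf, -, hzle, hsup⟩ := exists_supAbscissa hs₀ h1₀ h2₀
  have hstrip := strip_of_abscissa_le hΘhalf.le hzle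
  -- the hitting scale δ ∈ (0, 1] of the dense set, and the window-rise law with exponent Θ − 1/2
  obtain ⟨δ, hδ, hδ1, T, hT0, hhit⟩ := h3 θ C hθ A hA
  obtain ⟨B, hB0, hB⟩ := windowRise_of_strip hstrip
  -- δ' := min(δ, Θ − 1/2)/2, η := Θ − 1/2 − δ' ≥ 0, and a zero to the right of 1/2 + η
  obtain ⟨δ', hδ'pos, hδ'leδ, hδ'leΘ⟩ :
      ∃ δ' : ℝ, 0 < δ' ∧ δ' ≤ δ / 2 ∧ δ' ≤ (Θ - 1 / 2) / 2 := by
    refine ⟨min δ (Θ - 1 / 2) / 2, ?_, ?_, ?_⟩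
    · have : 0 < min δ (Θ - 1 / 2) := lt_min hδ (by linarith)
      positivity
    · have := min_le_left δ (Θ - 1 / 2); linarith
    · have := min_le_right δ (Θ - 1 / 2); linarith
  have hη0 : 0 ≤ Θ - 1 / 2 - δ' := by linarith
  have hzero : ∃ ρ : ℂ, riemannZeta ρ = 0 ∧ 1 / 2 + (Θ - 1 / 2 - δ') < ρ.re ∧ ρ.re < 1 := by
    obtain ⟨ρ, hρ, hyρ, -, hρ2⟩ := hsup (Θ - δ') (by linarith)
    exact ⟨ρ, hρ, by linarith, hρ2⟩
  -- a deep negative value beyond max T 1, with K := B e^{Θ − 1/2} + 1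
  obtain ⟨t₀, hTt₀', ht₀0, hdeep⟩ :=
    h1 (Θ - 1 / 2 - δ') hη0 hzero (B * Real.exp (Θ - 1 / 2) + 1) (max T 1)
  have hTt₀ : T ≤ t₀ := (le_max_left T 1).trans hTt₀'
  -- it persists on the window [t₀, t₀ + L], L := e^{−δ t₀} ≤ 1, √L = e^{−δ t₀/2}
  have hL1 : Real.exp (-(δ * t₀)) ≤ 1 := by
    rw [Real.exp_le_one_iff]
    have := mul_nonneg hδ.le ht₀0
    linarith
  have hLsq : Real.exp (-(δ * t₀)) = Real.exp (-(δ * t₀) / 2) ^ 2 := by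
    rw [sq, ← Real.exp_add]
    congr 1
    ring
  have hkey : Real.exp ((Θ - 1 / 2) * (t₀ + 1)) * Real.exp (-(δ * t₀) / 2) ≤
      Real.exp (Θ - 1 / 2) * Real.exp ((Θ - 1 / 2 - δ') * t₀) := by
    rw [← Real.exp_add, ← Real.exp_add]
    apply Real.exp_le_exp.2
    have hprod : δ' * t₀ ≤ δ / 2 * t₀ := mul_le_mul_of_nonneg_right hδ'leδ ht₀0
    linarith
  have hneg : ∀ t : ℝ, t₀ ≤ t → t ≤ t₀ + Real.exp (-(δ * t₀)) → zetaScrew t < 0 := by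
    intro t h1t h2t
    have hrise := hB t₀ t ht₀0 h1t
    have httL : t - t₀ ≤ Real.exp (-(δ * t₀)) := by linarith
    have ht1 : t ≤ t₀ + 1 := by linarith
    have hroot : Real.sqrt (t - t₀) ≤ Real.exp (-(δ * t₀) / 2) := by
      rw [Real.sqrt_le_left (Real.exp_pos _).le, ← hLsq]
      exact httL
    have hcoef : 0 ≤ Θ - 1 / 2 := by linarith
    have hexp1 : Real.exp ((Θ - 1 / 2) * t) ≤ Real.exp ((Θ - 1 / 2) * (t₀ + 1)) :=
      Real.exp_le_exp.2 (mul_le_mul_of_nonneg_left ht1 hcoef)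
    -- rise ≤ B e^{(Θ−1/2)(t₀+1)} e^{−δ t₀/2} ≤ B e^{Θ−1/2} e^{η t₀}
    have hr1 : B * Real.exp ((Θ - 1 / 2) * t) * Real.sqrt (t - t₀) ≤
        B * Real.exp ((Θ - 1 / 2) * (t₀ + 1)) * Real.exp (-(δ * t₀) / 2) := by
      apply mul_le_mul (mul_le_mul_of_nonneg_left hexp1 hB0) hroot (Real.sqrt_nonneg _)
      exact mul_nonneg hB0 (Real.exp_pos _).le
    have hr2 : B * Real.exp ((Θ - 1 / 2) * (t₀ + 1)) * Real.exp (-(δ * t₀) / 2) ≤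
        B * (Real.exp (Θ - 1 / 2) * Real.exp ((Θ - 1 / 2 - δ') * t₀)) := by
      rw [mul_assoc]
      exact mul_le_mul_of_nonneg_left hkey hB0
    have hE : 0 < Real.exp ((Θ - 1 / 2 - δ') * t₀) := Real.exp_pos _
    have habs := le_abs_self (zetaScrew t - zetaScrew t₀)
    -- Ψ(t) ≤ Ψ(t₀) + rise < −(B e^{Θ−1/2} + 1) e^{η t₀} + B e^{Θ−1/2} e^{η t₀} = −e^{η t₀} < 0
    linarith [hrise, hr1, hr2, hdeep, hE, habs]
  -- but the dense set has a node in the window, where Ψ∘log ≥ 0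
  obtain ⟨a, haA, -, h1a, h2a⟩ := hhit t₀ (Real.exp (-(δ * t₀))) hTt₀ le_rfl
  exact absurd (hpos a haA) (not_le.2 (hneg (Real.log a) h1a h2a))

/-! ## 5. RH ⟺ `Ψ` uniformly ½-Hölder on `[0, ∞)` (modulo S1) -/

/-- S1 turns a global ½-Hölder modulus into RH: the modulus gives the floor `Ψ(t) ≥ −|B|√t`
(`Ψ(0) = 0`), while an off-line zero gives `Ψ(t) < −K e^{ηt}` for every `K` (S1). -/
theorem rh_of_sqrtHolder
    (h1 : ∀ η : ℝ, 0 ≤ η → (∃ ρ : ℂ, riemannZeta ρ = 0 ∧ 1 / 2 + η < ρ.re ∧ ρ.re < 1) →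
      ∀ K T : ℝ, ∃ t : ℝ, T ≤ t ∧ 0 ≤ t ∧ zetaScrew t < -K * Real.exp (η * t))
    (hH : ∃ B : ℝ, ∀ t₀ t : ℝ, 0 ≤ t₀ → t₀ ≤ t →
      |zetaScrew t - zetaScrew t₀| ≤ B * Real.sqrt (t - t₀)) :
    _root_.RiemannHypothesis := by
  obtain ⟨B, hB⟩ := hH
  refine quasiRiemannHypothesis_one_half_iff_holds.1 fun s₀ hs₀ h1₀ h2₀ ↦ ?_
  -- η := (Re s₀ − 1/2)/2 > 0; the zero s₀ lies to the right of 1/2 + η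
  have hη : 0 < (s₀.re - 1 / 2) / 2 := by linarith
  have hzero : ∃ ρ : ℂ, riemannZeta ρ = 0 ∧ 1 / 2 + (s₀.re - 1 / 2) / 2 < ρ.re ∧ ρ.re < 1 :=
    ⟨s₀, hs₀, by linarith, h2₀⟩
  obtain ⟨t, ht1, -, hdeep⟩ :=
    h1 ((s₀.re - 1 / 2) / 2) hη.le hzero ((|B| + 1) / ((s₀.re - 1 / 2) / 2)) 1
  have ht0 : 0 ≤ t := zero_le_one.trans ht1
  -- the floor from the modulus at t₀ = 0
  have hfloor : -(|B| * Real.sqrt t) ≤ zetaScrew t := by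
    have h := hB 0 t le_rfl ht0
    rw [zetaScrew_zero, sub_zero, sub_zero] at h
    have h' : B * Real.sqrt t ≤ |B| * Real.sqrt t :=
      mul_le_mul_of_nonneg_right (le_abs_self B) (Real.sqrt_nonneg _)
    have := neg_abs_le (zetaScrew t)
    linarith
  -- K e^{ηt} ≥ K η t = (|B| + 1) t ≥ (|B| + 1) √t ≥ |B| √t + 1 for t ≥ 1
  have hsqrt1 : 1 ≤ Real.sqrt t := by rw [Real.one_le_sqrt]; exact ht1
  have hsqrtt : Real.sqrt t ≤ t := by
    rw [Real.sqrt_le_left ht0]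
    nlinarith
  have hexp : (s₀.re - 1 / 2) / 2 * t ≤ Real.exp ((s₀.re - 1 / 2) / 2 * t) := by
    have := Real.add_one_le_exp ((s₀.re - 1 / 2) / 2 * t)
    linarith
  have hK : (|B| + 1) * t ≤
      (|B| + 1) / ((s₀.re - 1 / 2) / 2) * Real.exp ((s₀.re - 1 / 2) / 2 * t) := by
    have hKpos : 0 ≤ (|B| + 1) / ((s₀.re - 1 / 2) / 2) := by positivity
    have hc : (s₀.re - 1 / 2) / 2 ≠ 0 := hη.ne'
    calc (|B| + 1) * t = (|B| + 1) / ((s₀.re - 1 / 2) / 2) * ((s₀.re - 1 / 2) / 2 * t) := by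
          rw [div_mul_eq_mul_div, eq_div_iff hc]
          ring
      _ ≤ (|B| + 1) / ((s₀.re - 1 / 2) / 2) * Real.exp ((s₀.re - 1 / 2) / 2 * t) :=
          mul_le_mul_of_nonneg_left hexp hKpos
  have hBt : |B| * Real.sqrt t + 1 ≤ (|B| + 1) * t := by
    have h0 : 0 ≤ |B| := abs_nonneg B
    nlinarith
  linarith [hfloor, hK, hBt, hdeep]

/-- **RH ⟺ `Ψ` is uniformly ½-Hölder on `[0, ∞)`**, modulo S1 (proved in the cell's g9 file as
`ScrewGradedFloor.omegaDepth`): `RH ↔ ∃ B, ∀ 0 ≤ t₀ ≤ t, |Ψ(t) − Ψ(t₀)| ≤ B √(t − t₀)`. -/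
theorem rh_iff_sqrtHolder_of
    (h1 : ∀ η : ℝ, 0 ≤ η → (∃ ρ : ℂ, riemannZeta ρ = 0 ∧ 1 / 2 + η < ρ.re ∧ ρ.re < 1) →
      ∀ K T : ℝ, ∃ t : ℝ, T ≤ t ∧ 0 ≤ t ∧ zetaScrew t < -K * Real.exp (η * t)) :
    _root_.RiemannHypothesis ↔ ∃ B : ℝ, ∀ t₀ t : ℝ, 0 ≤ t₀ → t₀ ≤ t →
      |zetaScrew t - zetaScrew t₀| ≤ B * Real.sqrt (t - t₀) :=
  ⟨fun hRH ↦ let ⟨B, _, hB⟩ := sqrtHolder_of_RH hRH; ⟨B, hB⟩, rh_of_sqrtHolder h1⟩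

/-! ## 6. Two sparse node sets: the primes (Hoheisel) and the perfect powers -/

/-- **The primes are `(C, θ)`-dense for some `θ < 1`** (Hoheisel's theorem, tree
`Literature.NumberTheory.Sieve.hoheisel_primes_short_intervals`, sorry-free): every `m ≥ 1` has a
prime `p` with `m ≤ p ≤ m + C m^θ`. -/
theorem primes_dense : ∃ θ : ℝ, θ < 1 ∧ ∃ C : ℝ, ∀ m : ℕ, 1 ≤ m →
    ∃ p ∈ {p : ℕ | p.Prime}, m ≤ p ∧ (p : ℝ) ≤ m + C * (m : ℝ) ^ θ := by
  obtain ⟨θ₀, hθ₀, x₀, hx₀⟩ := Literature.NumberTheory.Sieve.hoheisel_primes_short_intervals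
  -- work with θ := max θ₀ (1/2) ∈ [1/2, 1)
  have hθ1 : max θ₀ (1 / 2) < 1 := max_lt hθ₀ (by norm_num)
  have hθ0 : 0 < max θ₀ (1 / 2) := lt_of_lt_of_le (by norm_num) (le_max_right _ _)
  have hH : ∀ x : ℝ, max x₀ 1 ≤ x →
      ∃ p : ℕ, p.Prime ∧ x - x ^ max θ₀ (1 / 2) < p ∧ (p : ℝ) ≤ x := by
    intro x hx
    obtain ⟨p, hp, h1, h2⟩ := hx₀ x ((le_max_left _ _).trans hx)
    have hx1 : 1 ≤ x := (le_max_right _ _).trans hx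
    have : x ^ θ₀ ≤ x ^ max θ₀ (1 / 2) := Real.rpow_le_rpow_of_exponent_le hx1 (le_max_left _ _)
    exact ⟨p, hp, by linarith, h2⟩
  -- `4 m^θ ≤ m` for `m ≥ M`
  obtain ⟨M, hM⟩ : ∃ M : ℝ, ∀ x : ℝ, x ≥ M → (4 : ℝ) ≤ x ^ (1 - max θ₀ (1 / 2)) :=
    (Filter.tendsto_atTop.mp (tendsto_rpow_atTop (by linarith : 0 < 1 - max θ₀ (1 / 2))) 4)
      |>.exists_forall_of_atTop
  -- a prime `P` beyond the finite initial range
  obtain ⟨P, hPge, hP⟩ := Nat.exists_infinite_primes ⌈max (max x₀ 1) M⌉₊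
  refine ⟨max θ₀ (1 / 2), hθ1, max 4 P, fun m hm ↦ ?_⟩
  have hm1 : (1 : ℝ) ≤ m := by exact_mod_cast hm
  have hm0 : (0 : ℝ) ≤ m := by positivity
  have hmθ1 : 1 ≤ (m : ℝ) ^ max θ₀ (1 / 2) := Real.one_le_rpow hm1 hθ0.le
  have hC4 : (4 : ℝ) ≤ max 4 (P : ℝ) := le_max_left _ _
  have hCP : (P : ℝ) ≤ max 4 (P : ℝ) := le_max_right _ _
  by_cases hsmall : (m : ℝ) < max (max x₀ 1) M
  · -- small `m`: the fixed prime `P ≥ m` will do, since `m^θ ≥ 1`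
    refine ⟨P, hP, ?_, ?_⟩
    · have h1 : (m : ℝ) < P := by
        calc (m : ℝ) < max (max x₀ 1) M := hsmall
          _ ≤ ⌈max (max x₀ 1) M⌉₊ := Nat.le_ceil _
          _ ≤ P := by exact_mod_cast hPge
      exact_mod_cast h1.le
    · nlinarith
  · -- large `m`: Hoheisel at `x := m + 4 m^θ ≤ 2m`
    have hmR : max (max x₀ 1) M ≤ m := not_lt.1 hsmall
    have h4 : 4 * (m : ℝ) ^ max θ₀ (1 / 2) ≤ m := by
      have h := hM m ((le_max_right _ _).trans hmR)
      have e : (m : ℝ) ^ max θ₀ (1 / 2) * (m : ℝ) ^ (1 - max θ₀ (1 / 2)) = m := by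
        rw [← Real.rpow_add (by linarith)]
        simp
      calc 4 * (m : ℝ) ^ max θ₀ (1 / 2)
          ≤ (m : ℝ) ^ (1 - max θ₀ (1 / 2)) * (m : ℝ) ^ max θ₀ (1 / 2) :=
            mul_le_mul_of_nonneg_right h (by positivity)
        _ = m := by rw [mul_comm, e]
    obtain ⟨p, hp, hlow, hup⟩ := hH (m + 4 * (m : ℝ) ^ max θ₀ (1 / 2))
      (((le_max_left _ _).trans hmR).trans (by linarith))
    have hxθ : (m + 4 * (m : ℝ) ^ max θ₀ (1 / 2)) ^ max θ₀ (1 / 2) ≤ 2 * (m : ℝ) ^ max θ₀ (1 / 2) := by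
      have h2m : (m + 4 * (m : ℝ) ^ max θ₀ (1 / 2)) ^ max θ₀ (1 / 2) ≤
          (2 * m) ^ max θ₀ (1 / 2) :=
        Real.rpow_le_rpow (by positivity) (by linarith) hθ0.le
      have h2 : (2 : ℝ) ^ max θ₀ (1 / 2) ≤ 2 := by
        conv_rhs => rw [← Real.rpow_one 2]
        exact Real.rpow_le_rpow_of_exponent_le (by norm_num) hθ1.le
      rw [Real.mul_rpow (by norm_num) hm0] at h2m
      nlinarith
    refine ⟨p, hp, ?_, ?_⟩
    · have h1 : (m : ℝ) - 1 < p := by linarith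
      have h2 : m - 1 < p := by
        have h3 : ((m - 1 : ℕ) : ℝ) < p := by push_cast [hm]; exact h1
        exact_mod_cast h3
      omega
    · nlinarith

/-- Bernoulli-type bound: `(s + 1)^{n+1} ≤ s^{n+1} + (n + 1)(s + 1)^n` for `s ≥ 0`. -/
private theorem add_one_pow_succ_le {s : ℝ} (hs : 0 ≤ s) :
    ∀ n : ℕ, (s + 1) ^ (n + 1) ≤ s ^ (n + 1) + ((n : ℝ) + 1) * (s + 1) ^ n
  | 0 => by simp
  | n + 1 => by
    have ih := add_one_pow_succ_le hs n
    have h1 : s ^ (n + 1) ≤ (s + 1) ^ (n + 1) := pow_le_pow_left₀ hs (by linarith) _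
    have h2 : (0 : ℝ) ≤ s + 1 := by linarith
    calc (s + 1) ^ (n + 1 + 1) = (s + 1) * (s + 1) ^ (n + 1) := by ring
      _ ≤ (s + 1) * (s ^ (n + 1) + ((n : ℝ) + 1) * (s + 1) ^ n) :=
          mul_le_mul_of_nonneg_left ih h2
      _ = s ^ (n + 1 + 1) + s ^ (n + 1) + ((n : ℝ) + 1) * (s + 1) ^ (n + 1) := by ring
      _ ≤ s ^ (n + 1 + 1) + (s + 1) ^ (n + 1) + ((n : ℝ) + 1) * (s + 1) ^ (n + 1) := by
          linarith
      _ = s ^ (n + 1 + 1) + (((n + 1 : ℕ) : ℝ) + 1) * (s + 1) ^ (n + 1) := by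
          push_cast
          ring

/-- **The `(q+1)`-th powers are `((q+1)2^q, q/(q+1))`-dense**: every `m ≥ 1` has
`m ≤ k^{q+1} ≤ m + (q+1) 2^q m^{q/(q+1)}` (`k = ⌈m^{1/(q+1)}⌉`). -/
theorem powers_dense (q : ℕ) : ∀ m : ℕ, 1 ≤ m →
    ∃ a ∈ {n : ℕ | ∃ k : ℕ, n = k ^ (q + 1)}, m ≤ a ∧
      (a : ℝ) ≤ m + ((q : ℝ) + 1) * 2 ^ q * (m : ℝ) ^ ((q : ℝ) / ((q : ℝ) + 1)) := by
  intro m hm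
  have hm0 : (0 : ℝ) ≤ m := by positivity
  have hm1 : (1 : ℝ) ≤ m := by exact_mod_cast hm
  have hq0 : (q + 1 : ℕ) ≠ 0 := Nat.succ_ne_zero q
  set s : ℝ := (m : ℝ) ^ ((q + 1 : ℕ) : ℝ)⁻¹ with hs
  have hs0 : 0 ≤ s := Real.rpow_nonneg hm0 _
  have hs1 : 1 ≤ s := Real.one_le_rpow hm1 (by positivity)
  have hsm : s ^ (q + 1) = m := Real.rpow_inv_natCast_pow hm0 hq0
  have hsq : s ^ q = (m : ℝ) ^ ((q : ℝ) / ((q : ℝ) + 1)) := by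
    rw [hs, ← Real.rpow_natCast, ← Real.rpow_mul hm0]
    congr 1
    push_cast
    field_simp
  set k : ℕ := ⌈s⌉₊ with hk
  have hks : s ≤ (k : ℝ) := Nat.le_ceil s
  have hks' : (k : ℝ) < s + 1 := Nat.ceil_lt_add_one hs0
  have hk0 : (0 : ℝ) ≤ k := by positivity
  refine ⟨k ^ (q + 1), ⟨k, rfl⟩, ?_, ?_⟩
  · have h : (m : ℝ) ≤ (k : ℝ) ^ (q + 1) := by
      rw [← hsm]
      exact pow_le_pow_left₀ hs0 hks _
    exact_mod_cast h
  · push_cast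
    have h1 : (k : ℝ) ^ (q + 1) ≤ (s + 1) ^ (q + 1) := pow_le_pow_left₀ hk0 hks'.le _
    have h2 := add_one_pow_succ_le hs0 q
    have h3 : (s + 1) ^ q ≤ (2 * s) ^ q := pow_le_pow_left₀ (by linarith) (by linarith) _
    rw [mul_pow] at h3
    have h4 : (0 : ℝ) ≤ (q : ℝ) + 1 := by positivity
    have h5 := mul_le_mul_of_nonneg_left h3 h4
    rw [← hsq, ← hsm]
    nlinarith

/-- **RH ⟺ `Ψ(log p) ≥ 0` for every prime `p`**, modulo S1 and S3 (both proved in this cell's g9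
files): the screw criterion sampled at the primes only (⟹ Suzuki 2023 Thm 1.7; ⟸ the rung
`powerSparseDetect_of` with `A` = the primes, dense by Hoheisel). -/
theorem rh_iff_nonneg_at_primes_of
    (h1 : ∀ η : ℝ, 0 ≤ η → (∃ ρ : ℂ, riemannZeta ρ = 0 ∧ 1 / 2 + η < ρ.re ∧ ρ.re < 1) →
      ∀ K T : ℝ, ∃ t : ℝ, T ≤ t ∧ 0 ≤ t ∧ zetaScrew t < -K * Real.exp (η * t))
    (h3 : ∀ θ C : ℝ, θ < 1 → ∀ A : Set ℕ,
      (∀ m : ℕ, 1 ≤ m → ∃ a ∈ A, m ≤ a ∧ (a : ℝ) ≤ m + C * (m : ℝ) ^ θ) →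
      ∃ δ : ℝ, 0 < δ ∧ δ ≤ 1 ∧ ∃ T : ℝ, 0 ≤ T ∧ ∀ t₀ L : ℝ, T ≤ t₀ → Real.exp (-(δ * t₀)) ≤ L →
        ∃ a ∈ A, 1 ≤ a ∧ t₀ ≤ Real.log a ∧ Real.log a ≤ t₀ + L) :
    _root_.RiemannHypothesis ↔ ∀ p : ℕ, p.Prime → 0 ≤ zetaScrew (Real.log p) := by
  constructor
  · intro hRH p _
    exact ZetaScrewThm17.zetaScrew_nonneg_of_RH hRH _
  · intro h
    obtain ⟨θ, hθ, C, hC⟩ := primes_dense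
    exact powerSparseDetect_of h1 h3 θ hθ C {p : ℕ | p.Prime} hC fun p hp ↦ h p hp

/-- **RH ⟺ `Ψ((q+1) log k) ≥ 0` for every `k ≥ 1`**, for each fixed `q : ℕ` (the screw criterion
sampled at the `(q+1)`-th powers; `q = 1`: the squares, g9 `rh_iff_nonneg_at_squares`; `q = 2`: the
cubes), modulo S1 and S3. -/
theorem rh_iff_nonneg_at_powers_of
    (h1 : ∀ η : ℝ, 0 ≤ η → (∃ ρ : ℂ, riemannZeta ρ = 0 ∧ 1 / 2 + η < ρ.re ∧ ρ.re < 1) →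
      ∀ K T : ℝ, ∃ t : ℝ, T ≤ t ∧ 0 ≤ t ∧ zetaScrew t < -K * Real.exp (η * t))
    (h3 : ∀ θ C : ℝ, θ < 1 → ∀ A : Set ℕ,
      (∀ m : ℕ, 1 ≤ m → ∃ a ∈ A, m ≤ a ∧ (a : ℝ) ≤ m + C * (m : ℝ) ^ θ) →
      ∃ δ : ℝ, 0 < δ ∧ δ ≤ 1 ∧ ∃ T : ℝ, 0 ≤ T ∧ ∀ t₀ L : ℝ, T ≤ t₀ → Real.exp (-(δ * t₀)) ≤ L →
        ∃ a ∈ A, 1 ≤ a ∧ t₀ ≤ Real.log a ∧ Real.log a ≤ t₀ + L)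
    (q : ℕ) :
    _root_.RiemannHypothesis ↔ ∀ k : ℕ, 1 ≤ k → 0 ≤ zetaScrew (((q : ℝ) + 1) * Real.log k) := by
  constructor
  · intro hRH k _
    exact ZetaScrewThm17.zetaScrew_nonneg_of_RH hRH _
  · intro h
    have hθ : (q : ℝ) / ((q : ℝ) + 1) < 1 := by
      rw [div_lt_one (by positivity)]
      linarith
    refine powerSparseDetect_of h1 h3 _ hθ (((q : ℝ) + 1) * 2 ^ q) {n : ℕ | ∃ k : ℕ, n = k ^ (q + 1)}
      (powers_dense q) ?_
    rintro n ⟨k, rfl⟩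
    rcases Nat.eq_zero_or_pos k with hk | hk
    · subst hk
      simp [zetaScrew_zero]
    · have : Real.log ((k ^ (q + 1) : ℕ) : ℝ) = ((q : ℝ) + 1) * Real.log k := by
        push_cast
        rw [Real.log_pow]
        push_cast
        ring
      rw [this]
      exact h k hk


end Summit.RiemannHypothesis.RiemannHypothesis.Theorems.Splittings.ScrewWindowRise

end
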